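import Summits.AtomisticToContinuum.FouriersLaw.Theses.HonestZwanzig

/-!
# `PositiveMemory` (crux stmt-AtomisticToContinuum-12694, route `HonestZwanzig`):
# the right margin `b.val + 2 + R ≤ N` is load-bearing — without it the PHANTOM bond `b = N - 1` refutes every slice
# (negative-side support, crux-disprover seat gen 2; from `Cruxes/PositiveMemory/Disproof.lean` §5)

`PositiveMemory` claims: for `pinnedChain ω₂ lam β γ` (all `> 0`) and `T > 0` there are `k₀ > 0` and `R` such that for
all `N ≥ 2`, every bulk bond `b` (`R ≤ b.val`, `b.val + 2 + R ≤ N`) and every limit `ρ = lim_{s↓0} schur_s(j_b, J)` one has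
`k₀ ≤ ρ` (objects `μ = gibbsMeasure N T`, `corr`, `lap`, `G`, `schur`, `J` of the route file, verbatim below).

The index type of bonds is `Fin N` (sites), and `OscillatorChain.bondCurrent N b` is the current through the bond
`(b, b+1)` — for the LAST site `b = N - 1` there is no such bond and the definition returns `0` (a sum over the empty set
of `j : Fin N` with `j.val = N`). The right margin `b.val + 2 + R ≤ N` is what excludes this phantom index (and, for
`R ≥ 1`, the genuine contact bonds). Sorry-free content:

* `bondCurrent_phantom` — `bondCurrent N b = 0` whenever `b.val + 1 = N` (any chain).
* `slice_false_without_rightMargin` — for EVERY chain parameter point, EVERY `T` (no sign needed), every `k₀ > 0` and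
  every `R`, the conclusion with the right margin deleted fails: at `N = R + 2`, `b = N - 1` (`R ≤ b.val` holds) the function
  `s ↦ schur_s(j_b, J)` is identically `0` (`j_b = 0` makes every `corr / lap` with `j_b` on the left vanish, whatever the
  measure and the kernels are), so the limit `ρ = 0` EXISTS and `k₀ ≤ 0` is absurd.
* `positiveMemory_false_without_rightMargin` — hence the crux with `b.val + 2 + R ≤ N →` deleted is false.

Moral for provers / planners: the right margin cannot be dropped AS TYPED, but only because of the phantom index; the
honest weakening "`b.val + 1 < N` instead of `b.val + 2 + R ≤ N`" (floor up to the right contact bond) is OPEN and, by the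
reflection symmetry `ρ_b = ρ_{N-2-b}` of the equilibrium chain, equivalent to dropping the LEFT margin `R ≤ b.val`; the
nearest-neighbour resistor calibration of the Schur gadget (Disproof.lean §5: `ρ_b = K` for every bond, contact resistance
drops out of the Schur complement exactly) suggests both margins are physically unnecessary (`R = 0`), i.e. `R` is a
convenience of the proof, not of the statement. This file does NOT refute the crux.
-/

noncomputable section

namespace Summit.AtomisticToContinuum.FouriersLaw.Theorems.PositiveMemory.Negative.FalseWithoutRightMargin

open MeasureTheory Filter Topology Set
open Literature.MathematicalPhysics.KineticTheory.HeatConduction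

/-- The phantom bond: for the last site `b = N - 1` there is no bond `(b, b+1)` and `bondCurrent N b = 0`
(empty indicator sum). [folklore] -/
theorem bondCurrent_phantom (P : OscillatorChain) {N : ℕ} (b : Fin N) (hb : b.val + 1 = N) :
    P.bondCurrent N b = 0 := by
  funext z
  unfold OscillatorChain.bondCurrent
  refine Finset.sum_eq_zero fun j _ => ?_
  have hj := j.isLt
  rw [if_neg (by omega)]

/-- **Without the right margin every slice is false** (all chain parameters, all `T`, all `k₀ > 0`, all `R`): at
`N = R + 2`, `b = N - 1` the map `s ↦ schur_s(j_b, J)` is identically zero because `j_b = 0`, so `ρ = 0` is a limit and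
`k₀ ≤ 0` fails. No property of `gibbsMeasure` / `transitionKernel` is used. [folklore] -/
theorem slice_false_without_rightMargin (ω₂ lam β γ T : ℝ) :
    ¬ ∃ k₀ : ℝ, 0 < k₀ ∧ ∃ R : ℕ, ∀ N : ℕ, 2 ≤ N → let P := Literature.MathematicalPhysics.KineticTheory.HeatConduction.pinnedChain ω₂ lam β γ; let X := Literature.MathematicalPhysics.KineticTheory.HeatConduction.PhaseSpace N; let μ : MeasureTheory.Measure X := P.gibbsMeasure N T; let corr : (X → ℝ) → (X → ℝ) → ℝ → ℝ := fun f g t => (∫ z, f z * (∫ y, g y ∂(P.transitionKernel N T T t.toNNReal z)) ∂μ) - (∫ z, f z ∂μ) * (∫ z, g z ∂μ); let lap : ℝ → (X → ℝ) → (X → ℝ) → ℝ := fun s f g => ∫ t in Set.Ioi (0 : ℝ), Real.exp (-(s * t)) * corr f g t; let e : Fin N → X → ℝ := fun x z => z.2 x ^ 2 / 2 + P.U (z.1 x) + ∑ j : Fin N, ((if j.val = x.val + 1 then P.V (z.1 j - z.1 x) / 2 else 0) + (if x.val = j.val + 1 then P.V (z.1 x - z.1 j) / 2 else 0)); let G :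 ℝ → Matrix (Fin N) (Fin N) ℝ := fun s => Matrix.of fun x y => lap s (e x) (e y); let schur : ℝ → (X → ℝ) → (X → ℝ) → ℝ := fun s f g => lap s f g - ∑ x : Fin N, ∑ y : Fin N, lap s f (e x) * (G s)⁻¹ x y * lap s (e y) g; let J : X → ℝ := fun z => ∑ i : Fin N, P.bondCurrent N i z; ∀ b : Fin N, R ≤ b.val → ∀ ρ : ℝ, Filter.Tendsto (fun s => schur s (P.bondCurrent N b) J) (nhdsWithin (0 : ℝ) (Set.Ioi 0)) (nhds ρ) → k₀ ≤ ρ := by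
  rintro ⟨k₀, hk₀, R, hR⟩
  have hN : 2 ≤ R + 1 + 1 := by omega
  have key := hR (R + 1 + 1) hN
  dsimp only at key
  have hb : R + 1 < R + 1 + 1 := by omega
  have hj : (pinnedChain ω₂ lam β γ).bondCurrent (R + 1 + 1) ⟨R + 1, hb⟩ = 0 :=
    bondCurrent_phantom _ _ rfl
  have h0 := key ⟨R + 1, hb⟩ (by simp only; omega) 0 ?_
  · linarith
  · rw [hj]
    simp only [Pi.zero_apply, zero_mul, integral_zero, sub_zero, mul_zero, Finset.sum_const_zero]
    exact tendsto_const_nhds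

/-- **`PositiveMemory` with the right margin `b.val + 2 + R ≤ N` deleted is false** (witness: any admissible parameter
point, e.g. `ω₂ = lam = β = γ = T = 1`; `N = R + 2`, phantom bond `b = N - 1`). Any proof of the crux must use the right
margin, if only to exclude `b = N - 1`. [folklore] -/
theorem positiveMemory_false_without_rightMargin :
    ¬ ∀ ω₂ lam β γ : ℝ, 0 < ω₂ → 0 < lam → 0 < β → 0 < γ → ∀ T : ℝ, 0 < T → ∃ k₀ : ℝ, 0 < k₀ ∧ ∃ R : ℕ, ∀ N : ℕ, 2 ≤ N → let P := Literature.MathematicalPhysics.KineticTheory.HeatConduction.pinnedChain ω₂ lam β γ; let X := Literature.MathematicalPhysics.KineticTheory.HeatConduction.PhaseSpace N; let μ : MeasureTheory.Measure X := P.gibbsMeasure N T; let corr : (X → ℝ) → (X → ℝ) → ℝ → ℝ := fun f g t => (∫ z, f z * (∫ y, g y ∂(P.transitionKernel N T T t.toNNReal z)) ∂μ) - (∫ z, f z ∂μ) * (∫ z, g z ∂μ); let lap : ℝ → (X → ℝ) → (X → ℝ) → ℝ := fun s f g => ∫ t in Set.Ioi (0 : ℝ), Real.exp (-(s * t)) *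 corr f g t; let e : Fin N → X → ℝ := fun x z => z.2 x ^ 2 / 2 + P.U (z.1 x) + ∑ j : Fin N, ((if j.val = x.val + 1 then P.V (z.1 j - z.1 x) / 2 else 0) + (if x.val = j.val + 1 then P.V (z.1 x - z.1 j) / 2 else 0)); let G : ℝ → Matrix (Fin N) (Fin N) ℝ := fun s => Matrix.of fun x y => lap s (e x) (e y); let schur : ℝ → (X → ℝ) → (X → ℝ) → ℝ := fun s f g => lap s f g - ∑ x : Fin N, ∑ y : Fin N, lap s f (e x) * (G s)⁻¹ x y * lap s (e y) g; let J : X → ℝ := fun z => ∑ i : Fin N, P.bondCurrent N i z; ∀ b : Fin N, R ≤ b.val → ∀ ρ : ℝ, Filter.Tendsto (fun s => schur s (P.bondCurrent N b) J) (nhdsWithin (0 : ℝ) (Set.Ioi 0)) (nhds ρ) → k₀ ≤ ρ := by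
  intro h
  exact slice_false_without_rightMargin 1 1 1 1 1 (h 1 1 1 1 one_pos one_pos one_pos one_pos 1 one_pos)

end Summit.AtomisticToContinuum.FouriersLaw.Theorems.PositiveMemory.Negative.FalseWithoutRightMargin

end
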